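import Mathlib
import Summits.QuantumAdvantage.AdviceFreeQNC0.OddPrimeStatements
import Summits.QuantumAdvantage.AdviceFreeQNC0.WalkFailFloor
import Summits.QuantumAdvantage.QuantumAdvantage.Theorems.AbsorptionDialF

set_option linter.dupNamespace false

/-!
# AbsorptionDial (H) — juntas have low degree over every field; the junta fail floor; the constant rungs `d ≤ p − 2` conditionally on the junta theorem (cell decomp-qadv, lens 4, g14 rev 7)

Prop-definition-free continuation of `AbsorptionDialF` (imports it; independent of part G; lands AFTER F; supports of the
degree axis of `X = NoPerfectPolyOdd`, item stmt-QuantumAdvantage-28487 of route-QuantumAdvantage-AbsorptionDial, and of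
stmt-QuantumAdvantage-26994 ≡ 26767):

* `cZ_eq_zero_of_irrelevant` — a function ignoring coordinate `i` has `c_S = 0` for every `S ∋ i` (`moeb_insert`);
  **`hasDeg_of_junta`**, `hasDegF_of_junta` — a junta on `≤ J` coordinates has `𝔽₂`- and `𝔽_p`-degree `≤ J`
  (coefficient criterion `hasDeg_iff_dvd_cZ` / `hasDegF_iff_dvd_cZ` of part F).
* **`junta_fail_floor`** — if every cut of a strategy vector is a junta on `≤ J` coordinates: `2^{n−(2J+3)}` losers
  (every charge, `n ≥ 2J+3`; `WalkFailFloor.ringWinU_fail_floor J`).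
* **`degF_fail_floor_of_junta`** — the same floor for every strategy vector of `𝔽_p`-cut-degree `≤ d`, `d ≤ p − 2`, UNDER THE
  HYPOTHESIS `hJ` that every Boolean function of `𝔽_p`-degree `≤ p − 2` is a junta on `≤ J` coordinates — the contrapositive of
  [Sun–Sun–Wang–Wu–Xia–Zheng, *On the degree of Boolean functions as polynomials over ℤ_m*, ICALP 2020, arXiv:1910.12458,
  Theorem 2 with k = 1: a non-degenerate Boolean function on n ≥ n₀(p) variables has 𝔽_p-degree ≥ p − 1]; the hypothesis is
  spelled out (no Prop definition, no axiom) — a Literature named fact can replace it when typed.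

0 sorry · no new axioms · no instance / notation / native_decide.
-/

open Finset
open Literature.Computability.MetaComplexity Literature.Computability.MetaComplexity.Smolensky
open Summit.QuantumAdvantage.AdviceFreeQNC0

namespace Summit.QuantumAdvantage.QuantumAdvantage.Theorems.AbsorptionDial

/-! ## JUNTAS: a junta on `J` coordinates has degree `≤ J` over every field; the junta fail floor; the constant
rungs `d ≤ p − 2` CONDITIONALLY on the junta theorem for `𝔽_p`-degree `≤ p − 2` Boolean functions
(Sun–Sun–Wang–Wu–Xia–Zheng, *On the degree of Boolean functions as polynomials over `ℤ_m`*, ICALP 2020 / arXiv:1910.12458,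
Theorem 2 with `k = 1`: a NON-DEGENERATE Boolean function on `n ≥ n₀(p)` variables has `𝔽_p`-degree `≥ p − 1`; contrapositive:
`𝔽_p`-degree `≤ p − 2` ⟹ junta on `< n₀(p)` coordinates — the hypothesis `hJ` below; `n₀(p)` is of hypergraph-Ramsey size). -/

section Junta

variable {n : ℕ}

/-- a function that ignores coordinate `i` has vanishing Möbius coefficient at every `S ∋ i`. -/
theorem cZ_eq_zero_of_irrelevant {f : (Fin n → Bool) → Bool} {i : Fin n}
    (hi : ∀ x : Fin n → Bool, f (Function.update x i true) = f x) {S : Finset (Fin n)} (hS : i ∈ S) :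
    cZ f S = 0 := by
  obtain ⟨S', hiS', rfl⟩ : ∃ S', i ∉ S' ∧ S = insert i S' :=
    ⟨S.erase i, Finset.notMem_erase i S, (Finset.insert_erase hS).symm⟩
  unfold cZ
  rw [moeb_insert (fv f) hiS']
  have hfun : (fun U => fv f (insert i U)) = fv f := by
    funext U
    have hb : bitsOf (insert i U) = Function.update (bitsOf U) i true := by
      funext j
      by_cases hj : j = i
      · subst hj; simp [bitsOf]
      · simp [bitsOf, Finset.mem_insert, hj]
    unfold fv; rw [hb, hi]
  rw [hfun, sub_self]

/-- **a junta on `K`, `|K| ≤ J`, has `𝔽₂`-degree `≤ J`** … -/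
theorem hasDeg_of_junta {f : (Fin n → Bool) → Bool} {K : Finset (Fin n)} {J : ℕ} (hKJ : K.card ≤ J)
    (hK : ∀ x z : Fin n → Bool, (∀ j ∈ K, x j = z j) → f x = f z) : HasDeg f J := by
  refine hasDeg_of_cZ_eq_zero fun S hS => ?_
  obtain ⟨i, hiS, hiK⟩ : ∃ i ∈ S, i ∉ K := Finset.exists_mem_notMem_of_card_lt_card (by omega)
  exact cZ_eq_zero_of_irrelevant (fun x => hK _ _ fun j hj => by
    rw [Function.update_of_ne (ne_of_mem_of_not_mem hj hiK)]) hiS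

/-- … and `𝔽_p`-degree `≤ J` for every prime `p`. -/
theorem hasDegF_of_junta {p : ℕ} [Fact p.Prime] {f : (Fin n → Bool) → Bool} {K : Finset (Fin n)} {J : ℕ}
    (hKJ : K.card ≤ J) (hK : ∀ x z : Fin n → Bool, (∀ j ∈ K, x j = z j) → f x = f z) : HasDegF p f J := by
  refine (hasDegF_iff_dvd_cZ f J).2 fun S hS => ?_
  obtain ⟨i, hiS, hiK⟩ : ∃ i ∈ S, i ∉ K := Finset.exists_mem_notMem_of_card_lt_card (by omega)
  rw [cZ_eq_zero_of_irrelevant (fun x => hK _ _ fun j hj => by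
    rw [Function.update_of_ne (ne_of_mem_of_not_mem hj hiK)]) hiS]
  exact dvd_zero _

end Junta

/-- **the junta fail floor**: if every cut of a strategy vector is a junta on at most `J` coordinates, the vector loses
the u-walk game on at least `2^{n−(2J+3)}` inputs (every charge, `n ≥ 2J+3`). -/
theorem junta_fail_floor (J : ℕ) {n : ℕ} (hn : 2 * J + 3 ≤ n) (c : ℕ)
    (y : Fin (n + 1) → (Fin n → Bool) → Bool)
    (hy : ∀ g, ∃ K : Finset (Fin n), K.card ≤ J ∧ ∀ x z : Fin n → Bool, (∀ j ∈ K, x j = z j) → y g x = y g z) :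
    2 ^ (n - (2 * J + 3)) ≤ (Finset.univ.filter fun u : Fin n → Bool => ringWinU c y u = false).card := by
  simpa using ringWinU_fail_floor J hn c y fun g => by
    obtain ⟨K, hKJ, hK⟩ := hy g
    exact hasDeg_of_junta hKJ hK

/-- **the constant rungs up to `p − 2`, conditionally on the junta theorem**: if every Boolean function of
`𝔽_p`-degree `≤ p − 2` (on any number of bits) is a junta on `≤ J` coordinates — hypothesis `hJ`, the
contrapositive of [Sun–Sun–Wang–Wu–Xia–Zheng 2020, Thm 2, k = 1] — then for every `d ≤ p − 2`, `n ≥ 2J+3` and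
every charge, every strategy vector of `𝔽_p`-cut-degree `≤ d` loses on `≥ 2^{n−(2J+3)}` inputs. -/
theorem degF_fail_floor_of_junta {p : ℕ} [Fact p.Prime] (J : ℕ)
    (hJ : ∀ (m : ℕ) (f : (Fin m → Bool) → Bool), HasDegF p f (p - 2) →
      ∃ K : Finset (Fin m), K.card ≤ J ∧ ∀ x z : Fin m → Bool, (∀ j ∈ K, x j = z j) → f x = f z)
    {d : ℕ} (hd : d ≤ p - 2) {n : ℕ} (hn : 2 * J + 3 ≤ n) (c : ℕ)
    (y : Fin (n + 1) → (Fin n → Bool) → Bool) (hy : ∀ g, HasDegF p (y g) d) :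
    2 ^ (n - (2 * J + 3)) ≤ (Finset.univ.filter fun u : Fin n → Bool => ringWinU c y u = false).card :=
  junta_fail_floor J hn c y fun g => hJ n (y g) (lowDeg_mono hd (hy g))

end Summit.QuantumAdvantage.QuantumAdvantage.Theorems.AbsorptionDial
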